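import Summits.CriticalPhenomena.PercolationContinuityZ3.Theorems.PercNearOneGluingNoHeavyQuantIndepBlobFar
import Summits.CriticalPhenomena.PercolationContinuityZ3.Theorems.PercNearOneGluingNoHeavyQuantIndepBlobThreeBlobs
import HarnessLib

/-!
# QUANT lane R8, Conjecture DIB\* — the TRANSPORT CELL: at floors `x ≥ 17/20` every instance whose LARGEST blob is HEAVY
# satisfies the row (Hall + antipodal-Harris weight transport, no credit arithmetic beyond the total mass)

builds on p205010 (kernel theorem, internal audit signed; external expert review pending)

Support file (`--supports stmt-CriticalPhenomena-4575`), QUANT lane typer seat prim-quant-stmt (gen 21).  Theorems only, no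
definitions, no sorries, standard axioms; vocabulary of `…QuantIndepBlobMoments` / `…QuantIndepBlobFar` (product weights
`∏ (if k ∈ W then p k else 1 − p k)`) and `…QuantRootReduction` / `…QuantDIBStar` (`TERM`, `term_cond`).

THE MECHANISM (new certificate item for the FS / B-S menus of LEAD-NOTES-G17–G19).  Split on a blob `k₀` of size `b ≤ j` and gate
`p` (`RootDec.term_cond`): `P(N ≥ j+1) = p·(1 − L) + (1 − p)·H` with `L = P(N' ≤ j − b)`, `H = P(N' ≥ j+1)` for the rest `N'`.
If every remaining gate is `≥ g₀ ≥ 1/2`, the rest has total mass `≥ 2j + 1 − b` and every remaining size is `≤ s` with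
`(k − 1)·s ≤ b`, then light configurations `{a(W) ≤ j − b}` inject into heavy STRICT supersets `{a(V) ≥ j + 1}`
(`IndepBlob.exists_injective_heavy_superset`: Hall's condition is the antipodal Harris inequality), each injection step adds at
least `k` blobs (added mass `≥ b + 1 > (k − 1)·s`), and opening `k` gates `≥ g₀` multiplies the weight by at least
`(g₀/(1 − g₀))^k` (`weight_transport_pow`), whence **the transport inequality `g₀^k · L ≤ (1 − g₀)^k · H`** (`transport_tail`).
Consequently `P(N ≥ j+1) ≥ min(p, 1 − p·(1 − g₀)^k/g₀^k)`, and **if `x ≤ p` and `(1 − g₀)^k ≤ (1 − x)·g₀^k` then `P(N ≥ j+1) ≥ x`**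
(`RootDec.term_ge_of_transport`) — whatever the credit.

THE CELL (Conjecture DIB\*, `Quant.IndepBlob.DIBStar`).  With `g₀ = x²` (no dead light: every gate `≥ x²`), `k₀` a LARGEST blob
(so `s = a k₀`, `k = 2`) which is HEAVY (`x ≤ g k₀ ≤ 1`, any gate, sure included) and `(1 − x²)² ≤ (1 − x)·x⁴`, i.e.
`x⁴ + x³ + x² ≥ 1 + x` — every floor `x ≥ 17/20` qualifies —, the row `x ≤ P(N ≥ j+1)` holds as soon as the total mass is
`≥ 2j + 1`, in particular under the discounted-credit hypothesis (`tail_ge_of_heavyLargest`, `tail_ge_of_heavyLargest_of_credit`);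
finer rests (`(k − 1)·a i ≤ a k₀` for `i ≠ k₀`) lower the floor threshold to `(1 − x²)^k ≤ (1 − x)·x^{2k}`
(`tail_ge_of_heavyLargest_fine`: `k = 3` from `x ≥ 0.80`, `k = 4` from `x ≥ 0.77`, any `x > 1/√2` for `k` large).
So inside the residual class of T-DIB (README V222′/V227: lumpy core, largest blob of gate `< 1`) the sub-class 'largest blob
heavy' is KERNEL at every floor `x ≥ 17/20` — the region `x ≈ 0.93`, `g k₀ = x` where the aggregate certificate `OneBigCert`
(p272761) is thinnest (margin 0.067) is covered with no real inequality beyond `x⁴ + x³ + x² ≥ 1 + x`.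
Numerical check (seat folder work/explore/tr4.py): 60 000 random instances of both statements, 0 violations.

NOVELTY.  presearch: "Hall-type injection of the lower tail into the upper tail of a weighted Bernoulli sum / biased EKR
stability with a distinguished summand" → the regime-(C) transport of `far_indepBlob` (this tree; prior art recorded there:
biased Erdős–Ko–Rado, Harris–Kleitman) is the only neighbour; corpus hybrid/vsearch ("monotone transport product measure lower tail
upper tail injection", "Harris Kleitman intersecting families weighted") and galaxy (`antipodal|Kleitman|biased EKR`) give the
classical inequalities, not this conditioned two-level form.  [this work]; the gluing rows served
[cite: KozmaNitzan2024, Conjecture 3 (p. 15)]; product weights [cite: Grimmett1999, §1.3 p. 10].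
-/

namespace Summit.CriticalPhenomena.PercolationContinuityZ3.Theorems

namespace Quant

namespace IndepBlob

open Finset

variable {ι : Type*} [Fintype ι] [DecidableEq ι]

/-! ### 1. Weight transport along `k` added gates -/

/-- **`k`-step weight transport.**  Gates `g₀ ≤ p i ≤ 1` with `g₀ ≥ 1/2`; for `W ⊆ V` with at least `k` added gates,
`g₀^k · w(W) ≤ (1 − g₀)^k · w(V)`: on the added set each factor changes from `1 − p i` to `p i`, and `g₀(1 − p i) ≤ (1 − g₀) p i`;
surplus added gates only help because `1 − g₀ ≤ g₀`. [this work] -/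
theorem weight_transport_pow {p : ι → ℝ} {g₀ : ℝ} (hhalf : 1 / 2 ≤ g₀) (hg₀1 : g₀ ≤ 1) (hp : ∀ i, g₀ ≤ p i)
    (hp1 : ∀ i, p i ≤ 1) {W V : Finset ι} (hWV : W ⊆ V) (k : ℕ) (hk : k ≤ (V \ W).card) :
    g₀ ^ k * (∏ i, if i ∈ W then p i else 1 - p i) ≤ (1 - g₀) ^ k * (∏ i, if i ∈ V then p i else 1 - p i) := by
  set T : Finset ι := V \ W with hT
  have hg₀0 : 0 < g₀ := by linarith
  have h1g₀ : 0 ≤ 1 - g₀ := by linarith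
  -- split both weights over `T` and `Tᶜ`
  have splitW : (∏ i, if i ∈ W then p i else 1 - p i) =
      (∏ i ∈ T, (if i ∈ W then p i else 1 - p i)) * ∏ i ∈ Tᶜ, (if i ∈ W then p i else 1 - p i) :=
    (Finset.prod_mul_prod_compl T _).symm
  have splitV : (∏ i, if i ∈ V then p i else 1 - p i) =
      (∏ i ∈ T, (if i ∈ V then p i else 1 - p i)) * ∏ i ∈ Tᶜ, (if i ∈ V then p i else 1 - p i) :=
    (Finset.prod_mul_prod_compl T _).symm
  have hTW : ∏ i ∈ T, (if i ∈ W then p i else 1 - p i) = ∏ i ∈ T, (1 - p i) := by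
    refine Finset.prod_congr rfl fun i hi => ?_
    rw [hT, Finset.mem_sdiff] at hi
    rw [if_neg hi.2]
  have hTV : ∏ i ∈ T, (if i ∈ V then p i else 1 - p i) = ∏ i ∈ T, p i := by
    refine Finset.prod_congr rfl fun i hi => ?_
    rw [hT, Finset.mem_sdiff] at hi
    rw [if_pos hi.1]
  have hC : ∏ i ∈ Tᶜ, (if i ∈ V then p i else 1 - p i) = ∏ i ∈ Tᶜ, (if i ∈ W then p i else 1 - p i) := by
    refine Finset.prod_congr rfl fun i hi => ?_
    rw [Finset.mem_compl, hT, Finset.mem_sdiff, not_and, not_not] at hi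
    by_cases hiW : i ∈ W
    · rw [if_pos hiW, if_pos (hWV hiW)]
    · have hiV : i ∉ V := fun hiV => hiW (hi hiV)
      rw [if_neg hiW, if_neg hiV]
  have hC0 : 0 ≤ ∏ i ∈ Tᶜ, (if i ∈ W then p i else 1 - p i) :=
    Finset.prod_nonneg fun i _ => by split_ifs <;> linarith [hp i, hp1 i, hhalf]
  -- on `T`: `g₀^{|T|} ∏ (1 − p) ≤ (1 − g₀)^{|T|} ∏ p`, termwise
  have hcoreT : g₀ ^ T.card * ∏ i ∈ T, (1 - p i) ≤ (1 - g₀) ^ T.card * ∏ i ∈ T, p i := by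
    rw [← Finset.prod_const, ← Finset.prod_const, ← Finset.prod_mul_distrib, ← Finset.prod_mul_distrib]
    refine Finset.prod_le_prod (fun i _ => mul_nonneg hg₀0.le (by linarith [hp1 i])) fun i _ => ?_
    linarith [hp i, hp1 i]
  -- discard the surplus added gates: `(1 − g₀)^{|T| − k} ≤ g₀^{|T| − k}`
  have hPT0 : 0 ≤ ∏ i ∈ T, (1 - p i) := Finset.prod_nonneg fun i _ => by linarith [hp1 i]
  have hPT1 : 0 ≤ ∏ i ∈ T, p i := Finset.prod_nonneg fun i _ => hg₀0.le.trans (hp i)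
  have hcore : g₀ ^ k * ∏ i ∈ T, (1 - p i) ≤ (1 - g₀) ^ k * ∏ i ∈ T, p i := by
    obtain ⟨m, hm⟩ := Nat.exists_eq_add_of_le hk
    rw [hm, pow_add, pow_add] at hcoreT
    have hgm : 0 < g₀ ^ m := pow_pos hg₀0 m
    have hle : (1 - g₀) ^ m ≤ g₀ ^ m := pow_le_pow_left₀ h1g₀ (by linarith) m
    -- `g₀^m · (g₀^k A) ≤ (1−g₀)^m · ((1−g₀)^k B) ≤ g₀^m · ((1−g₀)^k B)`
    have h2 : (1 - g₀) ^ k * (1 - g₀) ^ m * ∏ i ∈ T, p i ≤ (1 - g₀) ^ k * g₀ ^ m * ∏ i ∈ T, p i :=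
      mul_le_mul_of_nonneg_right (mul_le_mul_of_nonneg_left hle (pow_nonneg h1g₀ k)) hPT1
    have h3 : g₀ ^ m * (g₀ ^ k * ∏ i ∈ T, (1 - p i)) ≤ g₀ ^ m * ((1 - g₀) ^ k * ∏ i ∈ T, p i) := by
      calc g₀ ^ m * (g₀ ^ k * ∏ i ∈ T, (1 - p i)) = g₀ ^ k * g₀ ^ m * ∏ i ∈ T, (1 - p i) := by ring
        _ ≤ (1 - g₀) ^ k * (1 - g₀) ^ m * ∏ i ∈ T, p i := hcoreT
        _ ≤ (1 - g₀) ^ k * g₀ ^ m * ∏ i ∈ T, p i := h2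
        _ = g₀ ^ m * ((1 - g₀) ^ k * ∏ i ∈ T, p i) := by ring
    exact le_of_mul_le_mul_left h3 hgm
  rw [splitW, splitV, hTW, hTV, hC]
  calc g₀ ^ k * ((∏ i ∈ T, (1 - p i)) * ∏ i ∈ Tᶜ, (if i ∈ W then p i else 1 - p i))
      = (g₀ ^ k * ∏ i ∈ T, (1 - p i)) * ∏ i ∈ Tᶜ, (if i ∈ W then p i else 1 - p i) := by ring
    _ ≤ ((1 - g₀) ^ k * ∏ i ∈ T, p i) * ∏ i ∈ Tᶜ, (if i ∈ W then p i else 1 - p i) :=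
      mul_le_mul_of_nonneg_right hcore hC0
    _ = (1 - g₀) ^ k * ((∏ i ∈ T, p i) * ∏ i ∈ Tᶜ, (if i ∈ W then p i else 1 - p i)) := by ring

/-! ### 2. The transport inequality between the two tails -/

/-- **The transport inequality.**  Natural sizes `a i ≤ s`, gates `g₀ ≤ p i ≤ 1` with `g₀ ≥ 1/2`, levels `ℓ ≤ j` with total mass
`≥ j + ℓ + 1` and `(k − 1)·s ≤ j − ℓ`.  Then `g₀^k · P(N ≤ ℓ) ≤ (1 − g₀)^k · P(N ≥ j+1)`: the configurations of open mass `≤ ℓ`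
inject into strict supersets of open mass `≥ j + 1` (Hall + antipodal Harris, `exists_injective_heavy_superset`), each time
opening at least `k` further gates (added mass `≥ j + 1 − ℓ > (k − 1)·s`). [this work] -/
theorem transport_tail (p : ι → ℝ) (a : ι → ℕ) (g₀ : ℝ) (hhalf : 1 / 2 ≤ g₀) (hp : ∀ i, g₀ ≤ p i) (hp1 : ∀ i, p i ≤ 1)
    (ℓ j s k : ℕ) (hℓj : ℓ ≤ j) (hmass : j + ℓ + 1 ≤ ∑ i, a i) (hsize : ∀ i, a i ≤ s) (hk : (k - 1) * s ≤ j - ℓ) :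
    g₀ ^ k * (∑ W ∈ (Finset.univ : Finset (Finset ι)).filter (fun W => ∑ i ∈ W, a i ≤ ℓ),
        (∏ t, if t ∈ W then p t else 1 - p t)) ≤
      (1 - g₀) ^ k * (∑ V ∈ (Finset.univ : Finset (Finset ι)).filter (fun V => j + 1 ≤ ∑ i ∈ V, a i),
        (∏ t, if t ∈ V then p t else 1 - p t)) := by
  have hg₀0 : 0 < g₀ := by linarith
  have hg₀1 : g₀ ≤ 1 := by
    rcases (Finset.univ : Finset ι).eq_empty_or_nonempty with h | ⟨i, -⟩
    · exfalso
      rw [h, Finset.sum_empty] at hmass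
      omega
    · exact (hp i).trans (hp1 i)
  have h1g₀ : 0 ≤ 1 - g₀ := by linarith
  have hw0 : ∀ W : Finset ι, 0 ≤ (∏ t, if t ∈ W then p t else 1 - p t) :=
    bernoulliWeight_nonneg (fun i => hg₀0.le.trans (hp i)) hp1
  -- real-valued sizes and the injection
  set ar : ι → ℝ := fun i => (a i : ℝ) with har
  have har0 : ∀ i, 0 ≤ ar i := fun i => Nat.cast_nonneg _
  have hcast : ∀ W : Finset ι, ∑ i ∈ W, ar i = ((∑ i ∈ W, a i : ℕ) : ℝ) := fun W => by
    simp only [har, Nat.cast_sum]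
  have hle : ((ℓ : ℝ) + 1 / 2) + ((j : ℝ) + 1 / 2) ≤ ∑ i, ar i := by
    have h1 : ((j + ℓ + 1 : ℕ) : ℝ) ≤ ((∑ i, a i : ℕ) : ℝ) := by exact_mod_cast hmass
    rw [hcast]
    push_cast at h1 ⊢
    linarith
  obtain ⟨φ, hφinj, hφ⟩ := exists_injective_heavy_superset ar har0 ((ℓ : ℝ) + 1 / 2) ((j : ℝ) + 1 / 2) hle
  -- the light family, as a subtype
  have hlight_iff : ∀ W : Finset ι, ∑ i ∈ W, a i ≤ ℓ ↔ ∑ i ∈ W, ar i < (ℓ : ℝ) + 1 / 2 := by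
    intro W
    rw [hcast]
    constructor
    · intro h
      have h' : ((∑ i ∈ W, a i : ℕ) : ℝ) ≤ (ℓ : ℝ) := by exact_mod_cast h
      linarith
    · intro h
      by_contra hcon
      have h1 : ℓ + 1 ≤ ∑ i ∈ W, a i := by omega
      have h2 : (ℓ : ℝ) + 1 ≤ ((∑ i ∈ W, a i : ℕ) : ℝ) := by exact_mod_cast h1
      linarith
  have hheavy_of : ∀ V : Finset ι, (j : ℝ) + 1 / 2 ≤ ∑ i ∈ V, ar i → j + 1 ≤ ∑ i ∈ V, a i := by
    intro V h
    rw [hcast] at h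
    by_contra hcon
    have h1 : ∑ i ∈ V, a i ≤ j := by omega
    have h2 : ((∑ i ∈ V, a i : ℕ) : ℝ) ≤ (j : ℝ) := by exact_mod_cast h1
    linarith
  have hLeq : ∑ W ∈ (Finset.univ : Finset (Finset ι)).filter (fun W => ∑ i ∈ W, a i ≤ ℓ),
        (∏ t, if t ∈ W then p t else 1 - p t) =
      ∑ W : {W : Finset ι // ∑ i ∈ W, ar i < (ℓ : ℝ) + 1 / 2}, (∏ t, if t ∈ (W : Finset ι) then p t else 1 - p t) := by
    refine Finset.sum_subtype _ (fun W => ?_) _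
    rw [Finset.mem_filter]
    exact ⟨fun h => (hlight_iff W).1 h.2, fun h => ⟨Finset.mem_univ _, (hlight_iff W).2 h⟩⟩
  -- each injection step adds at least `k` gates
  have hcard : ∀ W : {W : Finset ι // ∑ i ∈ W, ar i < (ℓ : ℝ) + 1 / 2}, k ≤ (φ W \ (W : Finset ι)).card := by
    intro W
    have hWle : ∑ i ∈ (W : Finset ι), a i ≤ ℓ := (hlight_iff W).2 W.2
    have hVge : j + 1 ≤ ∑ i ∈ φ W, a i := hheavy_of (φ W) (hφ W).2
    have hsub : (W : Finset ι) ⊆ φ W := (hφ W).1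
    have hsplit : ∑ i ∈ φ W, a i = ∑ i ∈ φ W \ (W : Finset ι), a i + ∑ i ∈ (W : Finset ι), a i :=
      (Finset.sum_sdiff hsub).symm
    have hTmass : j + 1 - ℓ ≤ ∑ i ∈ φ W \ (W : Finset ι), a i := by omega
    have hTle : ∑ i ∈ φ W \ (W : Finset ι), a i ≤ (φ W \ (W : Finset ι)).card * s := by
      simpa only [smul_eq_mul] using Finset.sum_le_card_nsmul _ _ _ fun i _ => hsize i
    -- `(k − 1)·s ≤ j − ℓ < j + 1 − ℓ ≤ card·s`
    by_contra hcon
    have hck : (φ W \ (W : Finset ι)).card ≤ k - 1 := by omega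
    have : (φ W \ (W : Finset ι)).card * s ≤ (k - 1) * s := Nat.mul_le_mul_right s hck
    omega
  -- transport term by term
  have hstep : ∀ W : {W : Finset ι // ∑ i ∈ W, ar i < (ℓ : ℝ) + 1 / 2},
      g₀ ^ k * (∏ t, if t ∈ (W : Finset ι) then p t else 1 - p t) ≤
        (1 - g₀) ^ k * (∏ t, if t ∈ φ W then p t else 1 - p t) :=
    fun W => weight_transport_pow hhalf hg₀1 hp hp1 (hφ W).1 k (hcard W)
  have hsum : g₀ ^ k * ∑ W : {W : Finset ι // ∑ i ∈ W, ar i < (ℓ : ℝ) + 1 / 2},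
        (∏ t, if t ∈ (W : Finset ι) then p t else 1 - p t) ≤
      (1 - g₀) ^ k * ∑ W : {W : Finset ι // ∑ i ∈ W, ar i < (ℓ : ℝ) + 1 / 2},
        (∏ t, if t ∈ φ W then p t else 1 - p t) := by
    rw [Finset.mul_sum, Finset.mul_sum]
    exact Finset.sum_le_sum fun W _ => hstep W
  -- the image of `φ` lies in the heavy family
  have himage : ∑ W : {W : Finset ι // ∑ i ∈ W, ar i < (ℓ : ℝ) + 1 / 2}, (∏ t, if t ∈ φ W then p t else 1 - p t) ≤
      ∑ V ∈ (Finset.univ : Finset (Finset ι)).filter (fun V => j + 1 ≤ ∑ i ∈ V, a i),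
        (∏ t, if t ∈ V then p t else 1 - p t) := by
    rw [← Finset.sum_image (f := fun V : Finset ι => ∏ t, if t ∈ V then p t else 1 - p t) (s := Finset.univ) (g := φ)
      fun x _ y _ hxy => hφinj hxy]
    refine Finset.sum_le_sum_of_subset_of_nonneg (fun V hV => ?_) fun V _ _ => hw0 V
    rw [Finset.mem_image] at hV
    obtain ⟨W, -, rfl⟩ := hV
    rw [Finset.mem_filter]
    exact ⟨Finset.mem_univ _, hheavy_of (φ W) (hφ W).2⟩
  rw [hLeq]
  exact hsum.trans (mul_le_mul_of_nonneg_left himage (pow_nonneg h1g₀ k))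

end IndepBlob

namespace RootDec

open Finset

variable {κ : Type} [Fintype κ] [DecidableEq κ]

/-- product-Bernoulli weight of the set `W` of open blobs (as in `…QuantRootReduction`) -/
local notation3 "wt[" g ", " W "]" => ∏ k, (if k ∈ (W : Finset κ) then (g : κ → ℝ) k else 1 - (g : κ → ℝ) k)

/-- the TERM tail `P(s + Σ_{k open} a k ≥ j+1)` (as in `…QuantRootReduction`) -/
local notation3 "TERM[" s ", " a ", " g ", " j "]" =>
  ∑ W : Finset κ, wt[g, W] * (if (j : ℕ) + 1 ≤ (s : ℕ) + ∑ k ∈ W, (a : κ → ℕ) k then (1 : ℝ) else 0)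

/-! ### 3. The transport TERM rule -/

/-- **The transport TERM rule.**  Gates in `[0,1]` and all `≥ g₀ ≥ 1/2`; a blob `k₀` with `x ≤ g k₀` and `a k₀ ≤ j`; every other size
`≤ s` with `(k − 1)·s ≤ a k₀`; total mass `≥ 2j + 1`; and the floor condition `(1 − g₀)^k ≤ (1 − x)·g₀^k`.  Then `x ≤ P(N ≥ j+1)`.
Proof: `term_cond` at `k₀` gives `P = p(1 − L) + (1 − p)H` (`p = g k₀`, `L`/`H` the lower/upper tails of the rest at levels `j − a k₀` / `j + 1`);
`transport_tail` gives `g₀^k L ≤ (1 − g₀)^k H`; hence `P ≥ min(p, 1 − p(1 − g₀)^k/g₀^k) ≥ x`. [this work] -/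
theorem term_ge_of_transport (a : κ → ℕ) (g : κ → ℝ) (j : ℕ) (x g₀ : ℝ) (k₀ : κ) (s k : ℕ)
    (hg : ∀ i, 0 ≤ g i ∧ g i ≤ 1) (hhalf : 1 / 2 ≤ g₀) (hg₀ : ∀ i, g₀ ≤ g i)
    (hx : x ≤ g k₀) (hkj : a k₀ ≤ j) (hsize : ∀ i, i ≠ k₀ → a i ≤ s) (hk : (k - 1) * s ≤ a k₀)
    (hρ : (1 - g₀) ^ k ≤ (1 - x) * g₀ ^ k) (hmass : 2 * j + 1 ≤ ∑ i, a i) :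
    x ≤ ∑ W : Finset κ, wt[g, W] * (if j + 1 ≤ ∑ i ∈ W, a i then (1 : ℝ) else 0) := by
  have hg₀0 : 0 < g₀ := by linarith
  have h1g₀ : 0 ≤ 1 - g₀ := by linarith [hg₀ k₀, (hg k₀).2]
  set b : ℕ := a k₀ with hb
  set a' : κ → ℕ := Function.update a k₀ 0 with ha'
  have ha'k : a' k₀ = 0 := by rw [ha', Function.update_self]
  have ha'ne : ∀ i, i ≠ k₀ → a' i = a i := fun i hi => by rw [ha', Function.update_of_ne hi]
  have ha's : ∀ i, a' i ≤ s := by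
    intro i; by_cases hi : i = k₀
    · rw [hi, ha'k]; exact Nat.zero_le _
    · rw [ha'ne i hi]; exact hsize i hi
  -- the rest carries mass `≥ 2j + 1 − b = j + (j − b) + 1`
  have hmass' : j + (j - b) + 1 ≤ ∑ i, a' i := by
    have h1 : ∑ i, a i = a k₀ + ∑ i ∈ Finset.univ.erase k₀, a i := (Finset.add_sum_erase _ _ (Finset.mem_univ k₀)).symm
    have h2 : ∑ i, a' i = a' k₀ + ∑ i ∈ Finset.univ.erase k₀, a' i := (Finset.add_sum_erase _ _ (Finset.mem_univ k₀)).symm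
    have h3 : ∑ i ∈ Finset.univ.erase k₀, a' i = ∑ i ∈ Finset.univ.erase k₀, a i :=
      Finset.sum_congr rfl fun i hi => by rw [ha'ne i (Finset.ne_of_mem_erase hi)]
    rw [h2, h3, ha'k]
    omega
  -- the two tails of the rest
  set L : ℝ := ∑ W ∈ (Finset.univ : Finset (Finset κ)).filter (fun W => ∑ i ∈ W, a' i ≤ j - b), wt[g, W] with hL
  set H : ℝ := ∑ V ∈ (Finset.univ : Finset (Finset κ)).filter (fun V => j + 1 ≤ ∑ i ∈ V, a' i), wt[g, V] with hH
  have hw0 : ∀ W : Finset κ, 0 ≤ wt[g, W] := IndepBlob.bernoulliWeight_nonneg (fun i => (hg i).1) (fun i => (hg i).2)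
  have hL0 : 0 ≤ L := Finset.sum_nonneg fun W _ => hw0 W
  have hH1 : H ≤ 1 := (Finset.sum_le_sum_of_subset_of_nonneg (Finset.filter_subset _ _) fun W _ _ => hw0 W).trans_eq
    (IndepBlob.sum_bernoulliWeight g)
  -- transport: `g₀^k L ≤ (1 − g₀)^k H`
  have htr : g₀ ^ k * L ≤ (1 - g₀) ^ k * H :=
    IndepBlob.transport_tail g a' g₀ hhalf hg₀ (fun i => (hg i).2) (j - b) j s k (Nat.sub_le j b) hmass' ha's
      (by rw [Nat.sub_sub_self hkj]; exact hk)
  -- `TERM[b, a'] = 1 − L` and `TERM[0, a'] = H`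
  have hT1 : TERM[b, a', g, j] = 1 - L := by
    rw [term_shift b a' g j hkj, hL, Finset.sum_filter, eq_sub_iff_add_eq, ← Finset.sum_add_distrib]
    refine Eq.trans (Finset.sum_congr rfl fun W _ => ?_) (IndepBlob.sum_bernoulliWeight g)
    by_cases h : j - b + 1 ≤ ∑ i ∈ W, a' i
    · rw [if_pos h, if_neg (by omega), mul_one, add_zero]
    · rw [if_neg h, if_pos (by omega), mul_zero, zero_add]
  have hT0 : ∑ W : Finset κ, wt[g, W] * (if j + 1 ≤ ∑ i ∈ W, a' i then (1 : ℝ) else 0) = H := by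
    rw [hH, Finset.sum_filter]
    refine Finset.sum_congr rfl fun W _ => ?_
    split_ifs <;> simp
  -- the split at `k₀`
  have e := term_cond 0 a g j k₀
  simp only [zero_add] at e
  rw [e, show a k₀ = b from rfl, show Function.update a k₀ 0 = a' from rfl, hT1, hT0]
  -- real arithmetic: c = g₀^k > 0, d = (1 − g₀)^k, cL ≤ dH, d ≤ (1 − x)c, x ≤ p ≤ 1, 0 ≤ L, H ≤ 1
  set p : ℝ := g k₀ with hp
  set c : ℝ := g₀ ^ k with hc
  set d : ℝ := (1 - g₀) ^ k with hd
  have hc0 : 0 < c := pow_pos hg₀0 k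
  have hd0 : 0 ≤ d := pow_nonneg h1g₀ k
  have hp0 : 0 ≤ p := (hg k₀).1
  have hp1 : p ≤ 1 := (hg k₀).2
  have hpLH : p * (c * L) ≤ p * (d * H) := mul_le_mul_of_nonneg_left htr hp0
  suffices hmain : c * x ≤ c * (p * (1 - L) + (1 - p) * H) from le_of_mul_le_mul_left hmain hc0
  by_cases hcase : p * d ≤ c * (1 - p)
  · -- `P ≥ p ≥ x`
    have hH0 : 0 ≤ H := Finset.sum_nonneg fun W _ => hw0 W
    have key : c * (p * (1 - L) + (1 - p) * H) - c * x =
        c * (p - x) + (p * (d * H) - p * (c * L)) + H * (c * (1 - p) - p * d) := by ring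
    nlinarith [mul_nonneg hH0 (sub_nonneg.2 hcase), mul_nonneg hc0.le (sub_nonneg.2 hx)]
  · -- `P ≥ 1 − p·d/c ≥ 1 − d/c ≥ x`
    have hcase' : c * (1 - p) ≤ p * d := (not_le.1 hcase).le
    have key : c * (p * (1 - L) + (1 - p) * H) - c * x =
        (p * (d * H) - p * (c * L)) + (1 - H) * (p * d - c * (1 - p)) + (c * (1 - x) - p * d) := by ring
    have h3 : p * d ≤ c * (1 - x) := (mul_le_of_le_one_left hd0 hp1).trans (hρ.trans_eq (mul_comm _ _))
    nlinarith [mul_nonneg (sub_nonneg.2 hH1) (sub_nonneg.2 hcase')]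

/-! ### 4. The cell of Conjecture DIB\*: largest blob heavy, floor `x ≥ 17/20` -/

/-- The floor condition at `g₀ = x²`, `k = 2`: for `17/20 ≤ x ≤ 1`, `(1 − x²)² ≤ (1 − x)·(x²)²` (i.e. `x⁴ + x³ + x² ≥ 1 + x`;
at `x = 17/20` the slack is `0.0086`). [this work] -/
theorem transport_floor_two (x : ℝ) (hx : 17 / 20 ≤ x) (hx1 : x ≤ 1) : (1 - x ^ 2) ^ 2 ≤ (1 - x) * (x ^ 2) ^ 2 := by
  have hx0 : 0 ≤ x := by linarith
  have h2 : (17 / 20) * x ≤ x ^ 2 := by nlinarith [mul_nonneg hx0 (sub_nonneg.2 hx)]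
  have h3 : (17 / 20) ^ 2 * x ≤ x ^ 3 := by
    have := mul_le_mul_of_nonneg_left h2 hx0
    nlinarith
  have h4 : (17 / 20) ^ 3 * x ≤ x ^ 4 := by
    have := mul_le_mul_of_nonneg_left h3 hx0
    nlinarith
  -- `(1 − x)x⁴ − (1 − x²)² = (1 − x)(x⁴ + x³ + x² − x − 1)`
  have key : (1 - x) * (x ^ 2) ^ 2 - (1 - x ^ 2) ^ 2 = (1 - x) * (x ^ 4 + x ^ 3 + x ^ 2 - x - 1) := by ring
  have hpos : 0 ≤ x ^ 4 + x ^ 3 + x ^ 2 - x - 1 := by linarith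
  nlinarith [mul_nonneg (sub_nonneg.2 hx1) hpos, key]

/-- **THE TRANSPORT CELL OF DIB\* — largest blob heavy, every floor `17/20 ≤ x ≤ 1`.**  Gates in `[x², 1]` (no dead light; empty
blobs may be given gate `1`), a blob `k₀` of maximal size with `x ≤ g k₀` and `a k₀ ≤ j`, total mass `≥ 2j + 1`
⟹ `x ≤ P(N ≥ j+1)`.  No credit hypothesis is needed beyond the mass. [this work] -/
theorem tail_ge_of_heavyLargest (a : κ → ℕ) (g : κ → ℝ) (j : ℕ) (x : ℝ) (hx : 17 / 20 ≤ x) (hx1 : x ≤ 1)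
    (hg : ∀ i, 0 ≤ g i ∧ g i ≤ 1) (hfloor : ∀ i, x ^ 2 ≤ g i) (k₀ : κ) (hheavy : x ≤ g k₀)
    (hlargest : ∀ i, a i ≤ a k₀) (hkj : a k₀ ≤ j) (hmass : 2 * j + 1 ≤ ∑ i, a i) :
    x ≤ ∑ W : Finset κ, wt[g, W] * (if j + 1 ≤ ∑ i ∈ W, a i then (1 : ℝ) else 0) := by
  have hhalf : 1 / 2 ≤ x ^ 2 := by nlinarith
  refine term_ge_of_transport a g j x (x ^ 2) k₀ (a k₀) 2 hg hhalf hfloor hheavy hkj (fun i _ => hlargest i)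
    (by omega) ?_ hmass
  exact transport_floor_two x hx hx1

/-- **The transport cell under the discounted-credit hypothesis of Conjecture DIB\*** (`Quant.IndepBlob.DIBStar`, binder shape of
`DIBWith` with natural sizes): floor `17/20 ≤ x < 1`, gates in `[0,1]` with every gate `≥ x²` (no dead light, empty blobs sure or
at least `x²`), a LARGEST blob `k₀` which is HEAVY (`x ≤ g k₀`) and no heavy giant (`a k₀ ≤ j`), discounted credit `> 2j` ⟹ the row
`x ≤ P(N ≥ j+1)`.  (The credit is used only through `credit ≤ total mass`.) [this work] -/
theorem tail_ge_of_heavyLargest_of_credit (a : κ → ℕ) (g : κ → ℝ) (j : ℕ) (x : ℝ) (hx : 17 / 20 ≤ x) (hx1 : x < 1)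
    (hg : ∀ i, 0 ≤ g i ∧ g i ≤ 1) (hfloor : ∀ i, x ^ 2 ≤ g i) (k₀ : κ) (hheavy : x ≤ g k₀)
    (hlargest : ∀ i, a i ≤ a k₀) (hkj : a k₀ ≤ j)
    (hcredit : (2 * j : ℝ) < ∑ i, (a i : ℝ) * (if x ≤ g i then g i else (g i - x ^ 2) / (1 - x))) :
    x ≤ ∑ W : Finset κ, wt[g, W] * (if j + 1 ≤ ∑ i ∈ W, a i then (1 : ℝ) else 0) := by
  have hmass : 2 * j + 1 ≤ ∑ i, a i := by
    have h1 : ∑ i, (a i : ℝ) * (if x ≤ g i then g i else (g i - x ^ 2) / (1 - x)) ≤ ∑ i, (a i : ℝ) :=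
      Finset.sum_le_sum fun i _ => mul_le_of_le_one_right (Nat.cast_nonneg _)
        (IndepBlob.creditRate_le_one x (g i) hx1 (hg i).2)
    have h2 : ((2 * j : ℕ) : ℝ) < ((∑ i, a i : ℕ) : ℝ) := by push_cast; linarith
    have h3 : 2 * j < ∑ i, a i := by exact_mod_cast h2
    omega
  exact tail_ge_of_heavyLargest a g j x hx hx1.le hg hfloor k₀ hheavy hlargest hkj hmass

/-- **Finer rests lower the floor.**  Same cell with `(k − 1)·a i ≤ a k₀` for every `i ≠ k₀` and the floor condition
`(1 − x²)^k ≤ (1 − x)·(x²)^k` (`1/2 ≤ x²`): e.g. `k = 3` from `x ≥ 0.80`, `k = 4` from `x ≥ 0.77`. [this work] -/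
theorem tail_ge_of_heavyLargest_fine (a : κ → ℕ) (g : κ → ℝ) (j : ℕ) (x : ℝ) (k : ℕ) (hhalf : 1 / 2 ≤ x ^ 2)
    (hρ : (1 - x ^ 2) ^ k ≤ (1 - x) * (x ^ 2) ^ k)
    (hg : ∀ i, 0 ≤ g i ∧ g i ≤ 1) (hfloor : ∀ i, x ^ 2 ≤ g i) (k₀ : κ) (hheavy : x ≤ g k₀)
    (hfine : ∀ i, i ≠ k₀ → (k - 1) * a i ≤ a k₀) (hkj : a k₀ ≤ j) (hmass : 2 * j + 1 ≤ ∑ i, a i) :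
    x ≤ ∑ W : Finset κ, wt[g, W] * (if j + 1 ≤ ∑ i ∈ W, a i then (1 : ℝ) else 0) := by
  classical
  -- `s` = the largest size off `k₀` (or `0`)
  set s : ℕ := (Finset.univ.erase k₀).sup a with hs
  have hsize : ∀ i, i ≠ k₀ → a i ≤ s := fun i hi => Finset.le_sup (Finset.mem_erase.2 ⟨hi, Finset.mem_univ i⟩)
  have hk : (k - 1) * s ≤ a k₀ := by
    by_cases hne : (Finset.univ.erase k₀).Nonempty
    · obtain ⟨i, hi, hsi⟩ := Finset.exists_mem_eq_sup _ hne a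
      rw [hs, hsi]
      exact hfine i (Finset.ne_of_mem_erase hi)
    · rw [Finset.not_nonempty_iff_eq_empty] at hne
      rw [hs, hne, Finset.sup_empty, bot_eq_zero, mul_zero]
      exact Nat.zero_le _
  exact term_ge_of_transport a g j x (x ^ 2) k₀ s k hg hhalf hfloor hheavy hkj hsize hk hρ hmass

end RootDec

end Quant

end Summit.CriticalPhenomena.PercolationContinuityZ3.Theorems
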